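import Literature.NumberTheory.EllipticCurves.ZpExtensionProofs
import Literature.NumberTheory.EllipticCurves.ZpExtensionDihedralProofs
import Literature.NumberTheory.EllipticCurves.ZpExtensionRank
import HarnessLib

/-!
# `exists_isAnticyclotomic` from the `ℤ_p`-rank facts (assembly; proofs only)

`Literature.NumberTheory.EllipticCurves.ZpExtension.exists_isAnticyclotomic` (file `ZpExtension.lean`: an imaginary quadratic field
has an anticyclotomic `ℤ_p`-extension) is derived here from the class-field-theoretic named fact
`Literature.NumberTheory.EllipticCurves.ZpExtension.zpRank_eq_nrComplexPlaces_add_one` (file `ZpExtensionRank.lean`: for a number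
field of unit rank `0`, `Gal(K̃/K) ≃ ℤ_p^{r₂+1}`; Lang, *Cyclotomic Fields I–II*, Ch. 5 Thm. 5.2 =
Washington Thm. 13.4 with Leopoldt's `δ = 0`), used twice — for `K` (rank `2`) and for `ℚ`
(rank `1`) — by assembling

* the abstract index-two descent `Literature.NumberTheory.EllipticCurves.ZpExtension.exists_isAnticyclotomic_of_zpRank`
  (file `ZpExtensionDihedralProofs.lean`: `(-1)`-eigencharacter of complex conjugation, extension
  of `c`-invariant characters to `Γ_ℚ`, saturation), and
* the Galois glue of `ZpExtensionProofs.lean`: the image of `Γ_K → Γ_ℚ` has index two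
  (`Literature.NumberTheory.EllipticCurves.inv_mul_mem_range_absGaloisRestrict`) and some involution of `Γ_ℚ` — a complex
  conjugation — is not in it for `K` totally imaginary (`Literature.NumberTheory.EllipticCurves.exists_not_mem_range_absGaloisRestrict`).

So the only unproved input left under `exists_isAnticyclotomic` is global class field theory in the
precise form of the `ℤ_p`-rank count.

## Main statement

* `Literature.NumberTheory.EllipticCurves.ZpExtension.exists_isAnticyclotomic_of_zpRank_facts`:
  `zpRank…(ℚ) → zpRank…(K) → exists_isAnticyclotomic`.

## References

* [Greenberg1987] R. Greenberg, *Non-vanishing of certain values of `L`-functions* (1987), §2.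
* [Washington1997] L. C. Washington, *Introduction to Cyclotomic Fields*, 2nd ed., §13.1, Thm. 13.4.
* [Lang1990] S. Lang, *Cyclotomic Fields I and II*, GTM 121, Ch. 5 §5, Thm. 5.2.
-/

noncomputable section

universe u

namespace Literature.NumberTheory.EllipticCurves

namespace ZpExtension

open Field NumberField NumberField.InfinitePlace

variable {K : Type u} [Field K] [NumberField K] {p : ℕ} [Fact p.Prime]

/-- **The anticyclotomic `ℤ_p`-extension exists, given the `ℤ_p`-rank facts.**  For `K` imaginary
quadratic, `Gal(ℚ̃/ℚ) ≃ ℤ_p` and `Gal(K̃/K) ≃ ℤ_p²` (the named fact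
`zpRank_eq_nrComplexPlaces_add_one` for `ℚ` and for `K`, both of unit rank `0`) imply
`exists_isAnticyclotomic`: an involution `c ∈ Γ_ℚ ∖ Γ_K` (complex conjugation,
`exists_not_mem_range_absGaloisRestrict`), the index-two glue
(`inv_mul_mem_range_absGaloisRestrict`) and the descent `exists_isAnticyclotomic_of_zpRank`.
Ref: Greenberg (1987), §2; Washington, §13.1, Thm. 13.4. [cite: Greenberg1987, §2] -/
theorem exists_isAnticyclotomic_of_zpRank_facts (hℚ : zpRank_eq_nrComplexPlaces_add_one ℚ p)
    (hKr : zpRank_eq_nrComplexPlaces_add_one K p) :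
    exists_isAnticyclotomic (K := K) (p := p) := by
  intro _ hK himag
  exact exists_isAnticyclotomic_of_zpRank hK himag
    (fun ρ ρ' hρ hρ' => inv_mul_mem_range_absGaloisRestrict hK hρ hρ')
    (exists_not_mem_range_absGaloisRestrict K (Rat.castHom ℝ) himag) hℚ hKr

end ZpExtension

end Literature.NumberTheory.EllipticCurves
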